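import Summits.QuantumFields.YangMills.Theorems.ColdStartUniversalityLatticeLangevinDossSussmannUniqueness
import Summits.QuantumFields.YangMills.Theorems.ColdStartUniversalityLatticeLangevinGradientDriftFlat
import Literature.Analysis.ODE.PathDrivenVariationBound
import HarnessLib

/-!
# Route `ColdStartUniversality` (fixed-cut-off SZZ dynamics; Doss–Sussmann smoothing programme, file 1):
# THE TAMED DOSS–SUSSMANN FIELD — smoothness, global Lipschitz and derivative bounds uniform in the frame

Helper file (seat `ym-line-csu-p1`, g24).  The Doss–Sussmann random ODE of `…DossSussmannVectorODE` /
`…DossSussmannUniqueness` has the field `F(p, M)_e = (p_e)ᴴ · D_β(e' ↦ p_{e'} M_{e'})_e · p_e M_e` on the configuration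
space `Edge → (Fin N → Fin N → ℂ)` (elementwise sup norm), where the "frame" `p` is the free Brownian configuration
`ρB(t)` (unitary, so `‖p‖ ≤ 1`) and `D_β = driftLie β` is the Lie-algebra drift (a polynomial in the entries).  Here:
* `contDiff_entry_lieProj`, `contDiff_entry_driftLie` — entries of `𝐩(M(y))` and of `D_β(Q(y))_e` are `C^n` in a
  parameter `y` when the entries of `M(y)`, `Q(y)` are;
* `contDiff_dossSussmannField` — the raw field `(p, M) ↦ F(p, M)` is `C^∞` jointly;
* ★ `exists_tamed_dossSussmannField` — a TAMED field `G : Cfg × Cfg → Cfg`, `C^∞`, EQUAL to `F` whenever `‖M‖ ≤ 1`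
  (so on all `ρ(SU(2))`-valued configurations), with ONE constant `K ≥ 0` such that for every frame `‖p‖ ≤ 1`:
  `M ↦ G(p, M)` is `K`-Lipschitz and `‖DG(p, M)‖ ≤ K` for all `M` (smooth bump cut-off in `M`, compactness of
  `closedBall 0 1 × closedBall 0 2` in finite dimension).  This is the input under which the tree's path-driven ODE
  theory (`Literature.Analysis.ODE.exists_pathDriven_solution_family`, `contDiff_pathDriven_solution_family`,
  `norm_fderiv_pathDriven_solution_family_eval_le`, g24) yields a GLOBAL flow, smooth in the start, with derivative
  bounds uniform in the driving path (next file).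
THEOREMS ONLY, no sorry.  HONEST FRAMING: fixed-cut-off calculus; nothing K-uniform; no crux, rung or summit statement is
proved; the Yang–Mills mass gap is NOT proved.
-/

set_option autoImplicit false

noncomputable section

namespace Summit.QuantumFields.YangMills.Theorems.ColdStartUniversality

open MeasureTheory Finset Filter Set Metric Function
open scoped NNReal Matrix ComplexConjugate Topology ContDiff
open Literature.MathematicalPhysics.QuantumFieldTheory
open Literature.MathematicalPhysics.QuantumLattice (fundamentalRep fundamentalLatticeRep continuous_fundamentalRep
  fundamentalRep_mem_unitaryGroup)

variable {L : ℕ}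

/-! ## Entrywise smoothness of `𝐩` and of the Lie drift -/

section Smooth

open scoped Matrix.Norms.Elementwise

/-- Entries of `𝐩(M(y))` are `C^n` in `y` when the entries of `M(y)` are (`𝐩` is real-linear on the finite-dimensional
space of matrices). [folklore] -/
theorem contDiff_entry_lieProj {E : Type*} [NormedAddCommGroup E] [NormedSpace ℝ E] {n : WithTop ℕ∞}
    {M : E → Matrix (Fin (fundamentalLatticeRep 2).N) (Fin (fundamentalLatticeRep 2).N) ℂ}
    (hM : ∀ a b, ContDiff ℝ n fun y => M y a b) (k l : Fin (fundamentalLatticeRep 2).N) :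
    ContDiff ℝ n fun y => ((fundamentalLatticeRep 2).lieProj (M y)) k l := by
  have hMc : ContDiff ℝ n M := contDiff_pi.2 fun a => contDiff_pi.2 fun b => hM a b
  have hP : ContDiff ℝ n fun y => (fundamentalLatticeRep 2).lieProj (M y) :=
    (LinearMap.toContinuousLinearMap (fundamentalLatticeRep 2).lieProj).contDiff.comp hMc
  exact contDiff_pi.1 (contDiff_pi.1 hP k) l

/-- Entries of a finite sum of entrywise-`C^n` matrix functions are `C^n`. [folklore] -/
theorem contDiff_entry_sum {E : Type*} [NormedAddCommGroup E] [NormedSpace ℝ E] {n : WithTop ℕ∞} {ι : Type*}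
    (s : Finset ι) {M : ι → E → Matrix (Fin (fundamentalLatticeRep 2).N) (Fin (fundamentalLatticeRep 2).N) ℂ}
    (hM : ∀ i a b, ContDiff ℝ n fun y => M i y a b) (a b : Fin (fundamentalLatticeRep 2).N) :
    ContDiff ℝ n fun y => (∑ i ∈ s, M i y) a b := by
  have h : (fun y => (∑ i ∈ s, M i y) a b) = fun y => ∑ i ∈ s, M i y a b := by
    funext y; exact Matrix.sum_apply a b s (fun i => M i y)
  rw [h]
  exact ContDiff.sum fun i _ => hM i a b

/-- Entries of the rooted plaquette loops `rootedLoop Q e j b` are `C^n` in a parameter when the entries of `Q` are.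
[folklore] -/
theorem contDiff_entry_rootedLoop [NeZero L] {E : Type*} [NormedAddCommGroup E] [NormedSpace ℝ E] {n : WithTop ℕ∞}
    {Q : E → MatrixConfig 3 L (fundamentalLatticeRep 2).N}
    (hQ : ∀ e a b, ContDiff ℝ n fun y => Q y e a b) (e : Edge 3 L) (j : Fin 3) (b : Bool)
    (k l : Fin (fundamentalLatticeRep 2).N) :
    ContDiff ℝ n fun y => rootedLoop (Q y) e j b k l := by
  cases b
  · simp only [rootedLoop]
    exact contDiff_entry_mul (contDiff_entry_mul (contDiff_entry_mul (hQ _) (hQ _))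
      (contDiff_entry_conjTranspose (hQ _))) (contDiff_entry_conjTranspose (hQ _)) k l
  · simp only [rootedLoop]
    exact contDiff_entry_mul (contDiff_entry_mul (contDiff_entry_mul (hQ _)
      (contDiff_entry_conjTranspose (hQ _))) (contDiff_entry_conjTranspose (hQ _))) (hQ _) k l

/-- Entries of the Lie drift `D_β(Q)_e = β Σ_{j ≠ e.2} Σ_b 𝐩((rootedLoop Q e j b)ᴴ)` are `C^n` in a parameter when the
entries of `Q` are. [folklore] -/
theorem contDiff_entry_driftLie [NeZero L] {E : Type*} [NormedAddCommGroup E] [NormedSpace ℝ E] {n : WithTop ℕ∞}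
    {Q : E → MatrixConfig 3 L (fundamentalLatticeRep 2).N}
    (hQ : ∀ e a b, ContDiff ℝ n fun y => Q y e a b) (β : ℝ) (e : Edge 3 L)
    (k l : Fin (fundamentalLatticeRep 2).N) :
    ContDiff ℝ n fun y => (fundamentalLatticeRep 2).driftLie β (Q y) e k l := by
  simp only [LatticeRep.driftLie, Matrix.smul_apply]
  refine ContDiff.const_smul β ?_
  refine contDiff_entry_sum _ (fun j a b => contDiff_entry_sum _ (fun b' a' b'' => ?_) a b) k l
  exact contDiff_entry_lieProj (contDiff_entry_conjTranspose (contDiff_entry_rootedLoop hQ e j b')) a' b''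

end Smooth

/-! ## The raw Doss–Sussmann field is smooth -/

/-- **The raw Doss–Sussmann field is `C^∞` jointly in (frame, configuration).**  On the configuration space
`Edge → (Fin N → Fin N → ℂ)` the field `(p, M) ↦ (e ↦ (p_e)ᴴ · D_β(e' ↦ p_{e'} M_{e'})_e · p_e M_e)` of the Doss–Sussmann
random ODE (`hasDerivWithinAt_dossSussmann_vec`, with `p = ρB(t)`) is a polynomial in the entries, hence `C^n` for every
`n`. [folklore] -/
theorem contDiff_dossSussmannField [NeZero L] {n : WithTop ℕ∞} (β : ℝ) :
    ContDiff ℝ n fun q : (Edge 3 L → Fin (fundamentalLatticeRep 2).N → Fin (fundamentalLatticeRep 2).N → ℂ) ×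
        (Edge 3 L → Fin (fundamentalLatticeRep 2).N → Fin (fundamentalLatticeRep 2).N → ℂ) =>
      fun (e : Edge 3 L) (k l : Fin (fundamentalLatticeRep 2).N) =>
        ((Matrix.of (q.1 e))ᴴ *
          (fundamentalLatticeRep 2).driftLie β (fun e' => Matrix.of (q.1 e') * Matrix.of (q.2 e')) e *
          (Matrix.of (q.1 e) * Matrix.of (q.2 e))) k l := by
  have h1 : ∀ (e : Edge 3 L) (a b : Fin (fundamentalLatticeRep 2).N), ContDiff ℝ n
      fun q : (Edge 3 L → Fin (fundamentalLatticeRep 2).N → Fin (fundamentalLatticeRep 2).N → ℂ) ×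
        (Edge 3 L → Fin (fundamentalLatticeRep 2).N → Fin (fundamentalLatticeRep 2).N → ℂ) =>
        (Matrix.of (q.1 e)) a b :=
    fun e a b => contDiff_pi.1 (contDiff_pi.1 (contDiff_pi.1 contDiff_fst e) a) b
  have h2 : ∀ (e : Edge 3 L) (a b : Fin (fundamentalLatticeRep 2).N), ContDiff ℝ n
      fun q : (Edge 3 L → Fin (fundamentalLatticeRep 2).N → Fin (fundamentalLatticeRep 2).N → ℂ) ×
        (Edge 3 L → Fin (fundamentalLatticeRep 2).N → Fin (fundamentalLatticeRep 2).N → ℂ) =>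
        (Matrix.of (q.2 e)) a b :=
    fun e a b => contDiff_pi.1 (contDiff_pi.1 (contDiff_pi.1 contDiff_snd e) a) b
  have hQ : ∀ (e : Edge 3 L) (a b : Fin (fundamentalLatticeRep 2).N), ContDiff ℝ n
      fun q : (Edge 3 L → Fin (fundamentalLatticeRep 2).N → Fin (fundamentalLatticeRep 2).N → ℂ) ×
        (Edge 3 L → Fin (fundamentalLatticeRep 2).N → Fin (fundamentalLatticeRep 2).N → ℂ) =>
        (fun e' => Matrix.of (q.1 e') * Matrix.of (q.2 e')) e a b :=
    fun e a b => contDiff_entry_mul (h1 e) (h2 e) a b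
  refine contDiff_pi.2 fun e => contDiff_pi.2 fun k => contDiff_pi.2 fun l => ?_
  exact contDiff_entry_mul (contDiff_entry_mul (contDiff_entry_conjTranspose (h1 e))
    (contDiff_entry_driftLie hQ β e)) (contDiff_entry_mul (h1 e) (h2 e)) k l

/-! ## The tamed field -/

/-- ★ **The tamed Doss–Sussmann field.**  There is a `C^∞` field `G` on (frame, configuration) pairs which COINCIDES with
the raw Doss–Sussmann field whenever `‖M‖ ≤ 1` (in particular at every `ρ(SU(2))`-valued configuration, whose entries
have modulus `≤ 1`), and ONE constant `K ≥ 0` such that for every frame with `‖p‖ ≤ 1` (e.g. `p = ρB(t)`): `‖G(p, M)‖ ≤ K`,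
`‖DG(p, M)‖ ≤ K` for all `M`, and `M ↦ G(p, M)` is `K`-Lipschitz (construction: a smooth bump function of `M` equal to
`1` on the closed unit ball and supported in the ball of radius `2`, times the raw field; the bounds by compactness of
`closedBall 0 1 × closedBall 0 2` in finite dimension and the mean value inequality). [folklore] -/
theorem exists_tamed_dossSussmannField [NeZero L] (β : ℝ) :
    ∃ G : (Edge 3 L → Fin (fundamentalLatticeRep 2).N → Fin (fundamentalLatticeRep 2).N → ℂ) ×
        (Edge 3 L → Fin (fundamentalLatticeRep 2).N → Fin (fundamentalLatticeRep 2).N → ℂ) →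
        (Edge 3 L → Fin (fundamentalLatticeRep 2).N → Fin (fundamentalLatticeRep 2).N → ℂ),
      ContDiff ℝ (⊤ : ℕ∞) G ∧
      (∀ p M, ‖M‖ ≤ 1 → G (p, M) = fun (e : Edge 3 L) (k l : Fin (fundamentalLatticeRep 2).N) =>
        ((Matrix.of (p e))ᴴ *
          (fundamentalLatticeRep 2).driftLie β (fun e' => Matrix.of (p e') * Matrix.of (M e')) e *
          (Matrix.of (p e) * Matrix.of (M e))) k l) ∧
      ∃ K : ℝ≥0,
        (∀ p M, ‖p‖ ≤ 1 → ‖G (p, M)‖ ≤ K) ∧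
        (∀ p M, ‖p‖ ≤ 1 → ‖fderiv ℝ G (p, M)‖ ≤ K) ∧
        (∀ p, ‖p‖ ≤ 1 → LipschitzWith K fun M => G (p, M)) := by
  -- abbreviations
  let Cfg : Type := Edge 3 L → Fin (fundamentalLatticeRep 2).N → Fin (fundamentalLatticeRep 2).N → ℂ
  let F : Cfg × Cfg → Cfg := fun q e k l =>
    ((Matrix.of (q.1 e))ᴴ *
      (fundamentalLatticeRep 2).driftLie β (fun e' => Matrix.of (q.1 e') * Matrix.of (q.2 e')) e *
      (Matrix.of (q.1 e) * Matrix.of (q.2 e))) k l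
  have hF : ∀ {n : WithTop ℕ∞}, ContDiff ℝ n F := fun {n} => contDiff_dossSussmannField (L := L) β
  -- the bump function
  let χ : ContDiffBump (0 : Cfg) := ⟨1, 2, one_pos, one_lt_two⟩
  let G : Cfg × Cfg → Cfg := fun q => (χ : Cfg → ℝ) q.2 • F q
  have hχ : ∀ {n : ℕ∞}, ContDiff ℝ n (χ : Cfg → ℝ) := fun {n} => χ.contDiff
  have hG : ∀ {n : ℕ∞}, ContDiff ℝ n G := fun {n} =>
    ((hχ (n := n)).comp contDiff_snd).smul (hF (n := n))
  have hG1 : ContDiff ℝ 1 G := hG (n := 1)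
  have hGd : Differentiable ℝ G := hG1.differentiable one_ne_zero
  have hGc' : Continuous (fderiv ℝ G) := hG1.continuous_fderiv one_ne_zero
  -- `G = F` on `‖M‖ ≤ 1`
  have hGF : ∀ p M, ‖M‖ ≤ 1 → G (p, M) = F (p, M) := fun p M hM => by
    have h1 : (χ : Cfg → ℝ) M = 1 := χ.one_of_mem_closedBall (by simpa using hM)
    rw [show G (p, M) = (χ : Cfg → ℝ) M • F (p, M) from rfl, h1, one_smul]
  -- `G = 0` near every `(p, M)` with `2 < ‖M‖`
  have hG0 : ∀ q : Cfg × Cfg, 2 < ‖q.2‖ → G =ᶠ[𝓝 q] fun _ => 0 := fun q hq => by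
    have hopen : IsOpen {q' : Cfg × Cfg | 2 < ‖q'.2‖} := isOpen_lt continuous_const (continuous_norm.comp continuous_snd)
    filter_upwards [hopen.mem_nhds hq] with q' hq'
    have h0 : (χ : Cfg → ℝ) q'.2 = 0 := χ.zero_of_le_dist (by simpa using hq'.le)
    rw [show G q' = (χ : Cfg → ℝ) q'.2 • F q' from rfl, h0, zero_smul]
  -- compactness bound on `closedBall 0 1 × closedBall 0 2`
  have hS : IsCompact (closedBall (0 : Cfg) 1 ×ˢ closedBall (0 : Cfg) 2) :=
    (isCompact_closedBall _ _).prod (isCompact_closedBall _ _)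
  obtain ⟨C₁, hC₁⟩ := hS.exists_bound_of_continuousOn hGc'.continuousOn
  obtain ⟨C₀, hC₀⟩ := hS.exists_bound_of_continuousOn (hG1.continuous).continuousOn
  set K : ℝ≥0 := Real.toNNReal (max C₀ C₁) with hK
  have hKC₀ : C₀ ≤ (K : ℝ) := by rw [hK, Real.coe_toNNReal']; exact (le_max_left _ _).trans (le_max_left _ _)
  have hKC₁ : C₁ ≤ (K : ℝ) := by rw [hK, Real.coe_toNNReal']; exact (le_max_right _ _).trans (le_max_left _ _)
  -- the two bounds
  have hbound0 : ∀ p M, ‖p‖ ≤ 1 → ‖G (p, M)‖ ≤ K := by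
    intro p M hp
    by_cases hM : ‖M‖ ≤ 2
    · exact (hC₀ (p, M) ⟨by simpa using hp, by simpa using hM⟩).trans hKC₀
    · have h := (hG0 (p, M) (lt_of_not_ge hM)).self_of_nhds
      simp only at h
      rw [h, norm_zero]; exact K.2
  have hbound1 : ∀ p M, ‖p‖ ≤ 1 → ‖fderiv ℝ G (p, M)‖ ≤ K := by
    intro p M hp
    by_cases hM : ‖M‖ ≤ 2
    · exact (hC₁ (p, M) ⟨by simpa using hp, by simpa using hM⟩).trans hKC₁
    · have h := (hG0 (p, M) (lt_of_not_ge hM)).fderiv_eq (𝕜 := ℝ)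
      rw [h]
      simp
  -- Lipschitz in `M` for every admissible frame
  have hlip : ∀ p, ‖p‖ ≤ 1 → LipschitzWith K fun M => G (p, M) := by
    intro p hp
    have hd : ∀ M, HasFDerivAt (fun M => G (p, M))
        ((fderiv ℝ G (p, M)).comp (ContinuousLinearMap.inr ℝ Cfg Cfg)) M :=
      fun M => (hGd (p, M)).hasFDerivAt.comp M (hasFDerivAt_prodMk_right (𝕜 := ℝ) p M)
    refine lipschitzWith_of_nnnorm_fderiv_le (fun M => (hd M).differentiableAt) fun M => ?_
    rw [(hd M).fderiv]
    have h : ‖(fderiv ℝ G (p, M)).comp (ContinuousLinearMap.inr ℝ Cfg Cfg)‖ ≤ K := by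
      refine ContinuousLinearMap.opNorm_le_bound _ K.2 fun v => ?_
      rw [ContinuousLinearMap.comp_apply, ContinuousLinearMap.inr_apply]
      calc ‖fderiv ℝ G (p, M) (0, v)‖ ≤ ‖fderiv ℝ G (p, M)‖ * ‖((0 : Cfg), v)‖ :=
            ContinuousLinearMap.le_opNorm _ _
        _ ≤ K * ‖v‖ := by
            have h0 : ‖((0 : Cfg), v)‖ ≤ ‖v‖ := by simp [Prod.norm_def]
            exact mul_le_mul (hbound1 p M hp) h0 (norm_nonneg _) K.2
    rw [← NNReal.coe_le_coe, coe_nnnorm]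
    exact h
  exact ⟨G, hG, fun p M hM => hGF p M hM, K, hbound0, hbound1, hlip⟩

end Summit.QuantumFields.YangMills.Theorems.ColdStartUniversality

end
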